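import Literature.NumberTheory.Sieve.PairDivisorSumsShifted
import HarnessLib

/-!
# Matomäki–Merikoski, (2.6) of the arXiv version ("ConsHenriot"): the `z_r`-tail of Proposition 2.3

Sibling of `Literature/Barriers/Parity/SiegelZeroPrimePairs.lean` (the catalogue entry vendoring
Matomäki–Merikoski, *Siegel zeros, twin primes, Goldbach's conjecture, and primes in short intervals*
(IMRN 2023; arXiv:2112.11412), Theorem 1.3 as the named fact
`Literature.Barriers.Parity.MatomakiMerikoski2023_pairCorrelation`).  Proposition 2.3 of the source
(the unconditional type-I₂ asymptotic over rough numbers) carries the error term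

  `∑_{r₁,r₂,r₃ ≥ 0, max r_j ≥ u/1000 − β} 2^{−A(r₁+r₂+r₃)} ∑_{m₁n₁ ≤ 10X, m₁n₁ + h = m₂n₂,`
  ` (n₁,P(z_{r₁})) = (n₂,P_h(z_{r₂})) = 1, (m₁,P(z_{r₃})) = (m₂, hP(z)) = 1} (τ(m₁)τ(n₁)τ(n₂))^{A+1}`,

`z = X^{1/u}`, `z_r = z^{((β−1)/β)^r}`, and display (2.6) of the arXiv version (p. 7; proved on p. 10
from Henriot's bound, Lemma 3.1(i) there) bounds it by `≪_A (h/φ(h)) (X/log² X) e^{−Au/2000}` once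
`β` is large in terms of `A` and `u ≥ 1000β`.  This file PROVES that bound, for the sign `+`
(`MatomakiMerikoski2023_consHenriot`), with the tree's coarse substitute for Henriot's bound
(`PairDivisorSums.sum_pow_card_divisors_shift_le`, exponents `κ(A)` in place of `2^{2A+3}+1, 2^{A+2}`;
the proof on p. 10 only uses that these exponents depend on `A` alone).  Rendering: the quadruple sum
is `∑_{n ≤ 10X} ∑_{m₁ ∣ n} ∑_{m₂ ∣ n+h}` with `n₁ = n/m₁`, `n₂ = (n+h)/m₂`; "`(k, P(w)) = 1`" is "every
prime factor of `k` is `≥ w`", "`(k, P_h(w)) = 1`" is "every prime factor `p < w` of `k` divides `h`",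
"`(m₂, hP(z)) = 1`" is "`m₂` coprime to `h` with all prime factors `≥ z`"; the sum over `r` is over
`r ∈ [0, R)³` for an arbitrary `R` (the bound does not depend on `R`); `A ≥ 1`.

Mechanism (p. 10): given `n`, the `(m₁, m₂)`-sum is at most
`τ(n)^{2A+3} τ(n+h)^{A+2} 1_{n z_{max(r₁,r₃)}-rough} 1_{(n+h, P_h(z_{r₂}))=1}` (`inner_divisor_sum_le`);
the coarse Lemma 3.1(i) with `wᵢ = max(2, z_r)` and `log X/log wᵢ ≤ u (β/(β−1))^{r}` gives
`≪ (h/φ(h)) X/log²X · u^{2κ+2} ρ^{(κ+1)(r₁+r₂+r₃)}`, `ρ = β/(β−1)`; for `β ≥ 2 + 15(κ+1)/A` one has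
`ρ^{κ+1} ≤ 2^{A/10}`, the triple geometric sum over `max r_j ≥ u/1000 − β` is `≤ 81 q^{⌈u/1000−β⌉}`
with `q ≤ 2^{−0.9A}`, and `u^{2κ+2} 2^{−0.9A(u/1000 − β)} ≪_{A,β} e^{−Au/2000}`.

## References

* K. Matomäki, J. Merikoski, IMRN 2023:23, 20337–20384 (arXiv:2112.11412): (2.6) of the arXiv version
  (p. 7) and its proof (§3.1, p. 10). [cite: MatomakiMerikoski2023, §2 (2.6) & §3.1]
* K. Henriot, Math. Proc. Cambridge Philos. Soc. 152 (2012) 405–424 (arXiv:1102.1643), Thm 3 — the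
  bound replaced here by `PairDivisorSums.sum_pow_card_divisors_shift_le`. [Henriot2012]
-/

noncomputable section

open Finset Real

namespace Literature.Barriers.Parity.MatomakiMerikoski

/-! ### Real-variable helpers -/

/-- `u^k e^{−δu} ≤ k!/δ^k` for `u ≥ 0`, `δ > 0`. [folklore] -/
private theorem pow_mul_exp_neg_le' (k : ℕ) {δ : ℝ} (hδ : 0 < δ) {u : ℝ} (hu : 0 ≤ u) :
    u ^ k * Real.exp (-(δ * u)) ≤ k.factorial / δ ^ k := by
  have h := Real.pow_div_factorial_le_exp (δ * u) (mul_nonneg hδ.le hu) k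
  have hfact : (0 : ℝ) < k.factorial := by exact_mod_cast Nat.factorial_pos k
  have hδk : 0 < δ ^ k := pow_pos hδ k
  have hexp : 0 < Real.exp (δ * u) := Real.exp_pos _
  rw [mul_pow, div_le_iff₀ hfact] at h
  rw [Real.exp_neg, le_div_iff₀ hδk]
  have : u ^ k * (Real.exp (δ * u))⁻¹ * δ ^ k = δ ^ k * u ^ k / Real.exp (δ * u) := by
    field_simp
  rw [this, div_le_iff₀ hexp]
  linarith

/-- Geometric tail with ratio `q ≤ 2/3`: `∑_{r < R, s ≤ r} q^r ≤ 3 q^{⌈s⌉₊}`. [folklore] -/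
private theorem geom_tail_le {q : ℝ} (hq0 : 0 ≤ q) (hq : q ≤ 2 / 3) (R : ℕ) (s : ℝ) :
    ∑ r ∈ (Finset.range R).filter (fun r : ℕ => s ≤ (r : ℝ)), q ^ r ≤ 3 * q ^ ⌈s⌉₊ := by
  have hsub : (Finset.range R).filter (fun r : ℕ => s ≤ (r : ℝ)) ⊆ Finset.Ico ⌈s⌉₊ R := by
    intro r hr
    rw [Finset.mem_filter, Finset.mem_range] at hr
    exact Finset.mem_Ico.mpr ⟨Nat.ceil_le.mpr hr.2, hr.1⟩
  calc _ ≤ ∑ r ∈ Finset.Ico ⌈s⌉₊ R, q ^ r :=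
        Finset.sum_le_sum_of_subset_of_nonneg hsub fun r _ _ => by positivity
    _ ≤ q ^ ⌈s⌉₊ / (1 - q) := geom_sum_Ico_le_of_lt_one hq0 (by linarith)
    _ ≤ 3 * q ^ ⌈s⌉₊ := by
        rw [div_le_iff₀ (by linarith)]
        nlinarith [pow_nonneg hq0 ⌈s⌉₊]

/-- Geometric sum with ratio `q ≤ 2/3`: `∑_{r < R} q^r ≤ 3`. [folklore] -/
private theorem geom_le_three {q : ℝ} (hq0 : 0 ≤ q) (hq : q ≤ 2 / 3) (R : ℕ) :
    ∑ r ∈ Finset.range R, q ^ r ≤ 3 := by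
  calc _ = ∑ r ∈ Finset.Ico 0 R, q ^ r := by rw [Finset.range_eq_Ico]
    _ ≤ q ^ 0 / (1 - q) := geom_sum_Ico_le_of_lt_one hq0 (by linarith)
    _ ≤ 3 := by rw [pow_zero, div_le_iff₀ (by linarith)]; linarith

/-- Factorisation of a product sum over a box. [folklore] -/
private theorem sum_box_mul (R : ℕ) (f g k : ℕ → ℝ) :
    ∑ r ∈ (Finset.range R ×ˢ Finset.range R) ×ˢ Finset.range R, f r.1.1 * g r.1.2 * k r.2 =
      (∑ a ∈ Finset.range R, f a) * (∑ b ∈ Finset.range R, g b) * (∑ c ∈ Finset.range R, k c) := by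
  rw [Finset.sum_product, Finset.sum_product, Finset.sum_mul_sum, Finset.sum_mul]
  refine Finset.sum_congr rfl fun a _ => ?_
  rw [Finset.sum_mul]
  refine Finset.sum_congr rfl fun b _ => ?_
  rw [Finset.mul_sum]

/-- The triple geometric sum over `max r_j ≥ s` with ratio `q ≤ 2/3`:
`∑_{r ∈ [0,R)³, max r_j ≥ s} q^{r₁+r₂+r₃} ≤ 81 q^{⌈s⌉₊}`. [folklore] -/
theorem triple_geom_le {q : ℝ} (hq0 : 0 ≤ q) (hq : q ≤ 2 / 3) (R : ℕ) (s : ℝ) :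
    ∑ r ∈ ((Finset.range R ×ˢ Finset.range R) ×ˢ Finset.range R).filter
        (fun r : (ℕ × ℕ) × ℕ => s ≤ ((max (max r.1.1 r.1.2) r.2 : ℕ) : ℝ)),
      q ^ (r.1.1 + r.1.2 + r.2) ≤ 81 * q ^ ⌈s⌉₊ := by
  rw [Finset.sum_filter]
  obtain ⟨I, hI⟩ : ∃ I : ℕ → ℝ, I = fun r : ℕ => if s ≤ (r : ℝ) then q ^ r else 0 := ⟨_, rfl⟩
  have hI0 : ∀ r, 0 ≤ I r := fun r => by rw [hI]; dsimp only; split_ifs <;> positivity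
  have hpt : ∀ r ∈ (Finset.range R ×ˢ Finset.range R) ×ˢ Finset.range R,
      (if s ≤ ((max (max r.1.1 r.1.2) r.2 : ℕ) : ℝ) then q ^ (r.1.1 + r.1.2 + r.2) else 0) ≤
        I r.1.1 * q ^ r.1.2 * q ^ r.2 + q ^ r.1.1 * I r.1.2 * q ^ r.2 +
          q ^ r.1.1 * q ^ r.1.2 * I r.2 := by
    intro r _
    have hA := hI0 r.1.1
    have hB := hI0 r.1.2
    have hC := hI0 r.2
    have hq1 := pow_nonneg hq0 r.1.1
    have hq2 := pow_nonneg hq0 r.1.2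
    have hq3 := pow_nonneg hq0 r.2
    have hn1 : 0 ≤ I r.1.1 * q ^ r.1.2 * q ^ r.2 := by positivity
    have hn2 : 0 ≤ q ^ r.1.1 * I r.1.2 * q ^ r.2 := by positivity
    have hn3 : 0 ≤ q ^ r.1.1 * q ^ r.1.2 * I r.2 := by positivity
    split_ifs with hmax
    · rw [Nat.cast_max, Nat.cast_max] at hmax
      simp only [le_max_iff] at hmax
      have e : q ^ (r.1.1 + r.1.2 + r.2) = q ^ r.1.1 * q ^ r.1.2 * q ^ r.2 := by rw [pow_add, pow_add]
      rw [e]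
      rcases hmax with (h | h) | h
      · have : I r.1.1 = q ^ r.1.1 := by rw [hI]; dsimp only; rw [if_pos h]
        rw [this] at hn1 ⊢
        linarith
      · have : I r.1.2 = q ^ r.1.2 := by rw [hI]; dsimp only; rw [if_pos h]
        rw [this] at hn2 ⊢
        linarith
      · have : I r.2 = q ^ r.2 := by rw [hI]; dsimp only; rw [if_pos h]
        rw [this] at hn3 ⊢
        linarith
    · linarith
  have hIsum : ∑ a ∈ Finset.range R, I a ≤ 3 * q ^ ⌈s⌉₊ := by
    rw [hI]
    dsimp only
    rw [← Finset.sum_filter]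
    exact geom_tail_le hq0 hq R s
  have hQ := geom_le_three hq0 hq R
  have hQ0 : 0 ≤ ∑ a ∈ Finset.range R, q ^ a := Finset.sum_nonneg fun _ _ => by positivity
  have hIs0 : 0 ≤ ∑ a ∈ Finset.range R, I a := Finset.sum_nonneg fun a _ => hI0 a
  have hqc : 0 ≤ q ^ ⌈s⌉₊ := by positivity
  calc ∑ r ∈ (Finset.range R ×ˢ Finset.range R) ×ˢ Finset.range R,
        (if s ≤ ((max (max r.1.1 r.1.2) r.2 : ℕ) : ℝ) then q ^ (r.1.1 + r.1.2 + r.2) else 0)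
      ≤ ∑ r ∈ (Finset.range R ×ˢ Finset.range R) ×ˢ Finset.range R,
          (I r.1.1 * q ^ r.1.2 * q ^ r.2 + q ^ r.1.1 * I r.1.2 * q ^ r.2 +
            q ^ r.1.1 * q ^ r.1.2 * I r.2) := Finset.sum_le_sum hpt
    _ = (∑ a ∈ Finset.range R, I a) * (∑ b ∈ Finset.range R, q ^ b) * (∑ c ∈ Finset.range R, q ^ c) +
        (∑ a ∈ Finset.range R, q ^ a) * (∑ b ∈ Finset.range R, I b) * (∑ c ∈ Finset.range R, q ^ c) +
        (∑ a ∈ Finset.range R, q ^ a) * (∑ b ∈ Finset.range R, q ^ b) * (∑ c ∈ Finset.range R, I c) := by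
        rw [Finset.sum_add_distrib, Finset.sum_add_distrib, sum_box_mul, sum_box_mul, sum_box_mul]
    _ ≤ (3 * q ^ ⌈s⌉₊) * 3 * 3 + 3 * (3 * q ^ ⌈s⌉₊) * 3 + 3 * 3 * (3 * q ^ ⌈s⌉₊) := by
        refine add_le_add (add_le_add ?_ ?_) ?_
        · exact mul_le_mul (mul_le_mul hIsum hQ hQ0 (by positivity)) hQ hQ0 (by positivity)
        · exact mul_le_mul (mul_le_mul hQ hIsum hIs0 (by positivity)) hQ hQ0 (by positivity)
        · exact mul_le_mul (mul_le_mul hQ hQ hQ0 (by positivity)) hIsum hIs0 (by positivity)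
    _ = 81 * q ^ ⌈s⌉₊ := by ring

/-- The scaling step: `C₁ F x/(lw₁ lw₂) (ℓ/lw₁)^κ (ℓ/lw₂)^κ ≤ 10·25^κ C₁ (F X/LX²) M₁^{κ+1} M₂^{κ+1}` when
`x ≤ 10X`, `ℓ ≤ 5 LX`, `1/lwᵢ ≤ Mᵢ/LX`. [folklore] -/
private theorem scale_bound {C₁ F x X ℓ LX lw₁ lw₂ M₁ M₂ : ℝ} (κ : ℕ) (hC₁ : 0 ≤ C₁) (hF : 0 ≤ F)
    (hX : 0 ≤ X) (hxX : x ≤ 10 * X) (hLX : 0 < LX) (hℓ0 : 0 ≤ ℓ) (hℓ : ℓ ≤ 5 * LX)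
    (hlw₁ : 0 < lw₁) (hlw₂ : 0 < lw₂) (hM₁ : 1 / lw₁ ≤ M₁ / LX) (hM₂ : 1 / lw₂ ≤ M₂ / LX) :
    C₁ * F * x / (lw₁ * lw₂) * ((ℓ / lw₁) ^ κ * (ℓ / lw₂) ^ κ) ≤
      10 * 25 ^ κ * C₁ * (F * X / LX ^ 2) * (M₁ ^ (κ + 1) * M₂ ^ (κ + 1)) := by
  have hM₁0 : 0 < M₁ := by
    have h := lt_of_lt_of_le (one_div_pos.mpr hlw₁) hM₁
    exact (div_pos_iff_of_pos_right hLX).mp h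
  have hM₂0 : 0 < M₂ := by
    have h := lt_of_lt_of_le (one_div_pos.mpr hlw₂) hM₂
    exact (div_pos_iff_of_pos_right hLX).mp h
  have h1 : ℓ / lw₁ ≤ 5 * M₁ := by
    calc ℓ / lw₁ = ℓ * (1 / lw₁) := by ring
      _ ≤ (5 * LX) * (M₁ / LX) := mul_le_mul hℓ hM₁ (by positivity) (by positivity)
      _ = 5 * M₁ := by field_simp
  have h2 : ℓ / lw₂ ≤ 5 * M₂ := by
    calc ℓ / lw₂ = ℓ * (1 / lw₂) := by ring
      _ ≤ (5 * LX) * (M₂ / LX) := mul_le_mul hℓ hM₂ (by positivity) (by positivity)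
      _ = 5 * M₂ := by field_simp
  have h3 : x / (lw₁ * lw₂) ≤ 10 * X * (M₁ / LX) * (M₂ / LX) := by
    calc x / (lw₁ * lw₂) = x * (1 / lw₁) * (1 / lw₂) := by field_simp
      _ ≤ (10 * X) * (M₁ / LX) * (M₂ / LX) :=
          mul_le_mul (mul_le_mul hxX hM₁ (by positivity) (by positivity)) hM₂ (by positivity)
            (by positivity)
  have h4 : (ℓ / lw₁) ^ κ * (ℓ / lw₂) ^ κ ≤ (5 * M₁) ^ κ * (5 * M₂) ^ κ :=
    mul_le_mul (pow_le_pow_left₀ (by positivity) h1 κ) (pow_le_pow_left₀ (by positivity) h2 κ)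
      (by positivity) (by positivity)
  calc C₁ * F * x / (lw₁ * lw₂) * ((ℓ / lw₁) ^ κ * (ℓ / lw₂) ^ κ)
      = C₁ * F * (x / (lw₁ * lw₂)) * ((ℓ / lw₁) ^ κ * (ℓ / lw₂) ^ κ) := by ring
    _ ≤ C₁ * F * (10 * X * (M₁ / LX) * (M₂ / LX)) * ((5 * M₁) ^ κ * (5 * M₂) ^ κ) :=
        mul_le_mul (mul_le_mul_of_nonneg_left h3 (by positivity)) h4 (by positivity) (by positivity)
    _ = 10 * 25 ^ κ * C₁ * (F * X / LX ^ 2) * (M₁ ^ (κ + 1) * M₂ ^ (κ + 1)) := by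
        rw [mul_pow, mul_pow, show (25 : ℝ) = 5 * 5 by norm_num, mul_pow]
        field_simp
        ring

/-! ### The pointwise combinatorial step -/

/-- `τ(d) ≤ τ(n)` for `d ∣ n`, `n ≠ 0`. [folklore] -/
private theorem card_divisors_le_of_dvd {d n : ℕ} (hn : n ≠ 0) (hd : d ∣ n) :
    d.divisors.card ≤ n.divisors.card :=
  Finset.card_le_card (Nat.divisors_subset_of_dvd hn hd)

/-- Given `n`, the `(m₁, m₂)`-sum of (2.6) is at most
`1_{n w₁-rough} 1_{(n+h, P_h(w₂)) = 1} τ(n)^{2A+3} τ(n+h)^{A+2}` as soon as the levels satisfy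
`t₁, t₃ ≥ w₁` and `t₂, t₀ ≥ w₂` on the primes (first display on p. 10 of the source).
[cite: MatomakiMerikoski2023, §3.1, proof of (2.6)] -/
theorem inner_divisor_sum_le (A : ℕ) {t₀ t₁ t₂ t₃ w₁ w₂ : ℝ} {n h : ℕ} (hn : n ≠ 0) (hnh : n + h ≠ 0)
    (hw₁ : ∀ p : ℕ, p.Prime → (t₁ ≤ p ∨ t₃ ≤ p) → w₁ ≤ p)
    (hw₂ : ∀ p : ℕ, p.Prime → (t₂ ≤ p ∨ t₀ ≤ p) → w₂ ≤ p) :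
    ∑ m₁ ∈ n.divisors, ∑ m₂ ∈ (n + h).divisors,
      (if (∀ p ∈ (n / m₁).primeFactors, t₁ ≤ (p : ℝ)) ∧
          (∀ p ∈ ((n + h) / m₂).primeFactors, t₂ ≤ (p : ℝ) ∨ p ∣ h) ∧
          (∀ p ∈ m₁.primeFactors, t₃ ≤ (p : ℝ)) ∧
          (Nat.Coprime m₂ h ∧ ∀ p ∈ m₂.primeFactors, t₀ ≤ (p : ℝ))
        then (((m₁.divisors.card * (n / m₁).divisors.card * ((n + h) / m₂).divisors.card : ℕ) : ℝ)) ^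
          (A + 1)
        else 0) ≤
    if (∀ p ∈ n.primeFactors, w₁ ≤ (p : ℝ)) ∧ (∀ p ∈ (n + h).primeFactors, w₂ ≤ (p : ℝ) ∨ p ∣ h)
      then ((n.divisors.card : ℝ)) ^ (2 * A + 3) * (((n + h).divisors.card : ℝ)) ^ (A + 2) else 0 := by
  by_cases hRC : (∀ p ∈ n.primeFactors, w₁ ≤ (p : ℝ)) ∧
      (∀ p ∈ (n + h).primeFactors, w₂ ≤ (p : ℝ) ∨ p ∣ h)
  · rw [if_pos hRC]
    have hterm : ∀ m₁ ∈ n.divisors, ∀ m₂ ∈ (n + h).divisors,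
        (if (∀ p ∈ (n / m₁).primeFactors, t₁ ≤ (p : ℝ)) ∧
            (∀ p ∈ ((n + h) / m₂).primeFactors, t₂ ≤ (p : ℝ) ∨ p ∣ h) ∧
            (∀ p ∈ m₁.primeFactors, t₃ ≤ (p : ℝ)) ∧
            (Nat.Coprime m₂ h ∧ ∀ p ∈ m₂.primeFactors, t₀ ≤ (p : ℝ))
          then (((m₁.divisors.card * (n / m₁).divisors.card * ((n + h) / m₂).divisors.card : ℕ) : ℝ)) ^
            (A + 1) else 0) ≤
          ((n.divisors.card : ℝ)) ^ (2 * A + 2) * (((n + h).divisors.card : ℝ)) ^ (A + 1) := by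
      intro m₁ hm₁ m₂ hm₂
      have hm₁d : m₁ ∣ n := Nat.dvd_of_mem_divisors hm₁
      have hm₂d : m₂ ∣ n + h := Nat.dvd_of_mem_divisors hm₂
      have h1 : m₁.divisors.card ≤ n.divisors.card := card_divisors_le_of_dvd hn hm₁d
      have h2 : (n / m₁).divisors.card ≤ n.divisors.card :=
        card_divisors_le_of_dvd hn (Nat.div_dvd_of_dvd hm₁d)
      have h3 : ((n + h) / m₂).divisors.card ≤ (n + h).divisors.card :=
        card_divisors_le_of_dvd hnh (Nat.div_dvd_of_dvd hm₂d)
      split_ifs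
      · have h4 : m₁.divisors.card * (n / m₁).divisors.card * ((n + h) / m₂).divisors.card ≤
            n.divisors.card * n.divisors.card * (n + h).divisors.card :=
          Nat.mul_le_mul (Nat.mul_le_mul h1 h2) h3
        have h5 : (((m₁.divisors.card * (n / m₁).divisors.card * ((n + h) / m₂).divisors.card : ℕ) : ℝ)) ≤
            ((n.divisors.card * n.divisors.card * (n + h).divisors.card : ℕ) : ℝ) := by exact_mod_cast h4
        calc _ ≤ (((n.divisors.card * n.divisors.card * (n + h).divisors.card : ℕ) : ℝ)) ^ (A + 1) :=
              pow_le_pow_left₀ (Nat.cast_nonneg _) h5 _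
          _ = ((n.divisors.card : ℝ)) ^ (2 * A + 2) * (((n + h).divisors.card : ℝ)) ^ (A + 1) := by
              push_cast; ring
      · positivity
    calc _ ≤ ∑ m₁ ∈ n.divisors, ∑ m₂ ∈ (n + h).divisors,
          ((n.divisors.card : ℝ)) ^ (2 * A + 2) * (((n + h).divisors.card : ℝ)) ^ (A + 1) :=
          Finset.sum_le_sum fun m₁ hm₁ => Finset.sum_le_sum fun m₂ hm₂ => hterm m₁ hm₁ m₂ hm₂
      _ = ((n.divisors.card : ℝ)) ^ (2 * A + 3) * (((n + h).divisors.card : ℝ)) ^ (A + 2) := by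
          rw [Finset.sum_const, Finset.sum_const, nsmul_eq_mul, nsmul_eq_mul]; ring
  · rw [if_neg hRC]
    refine (Finset.sum_eq_zero fun m₁ hm₁ => Finset.sum_eq_zero fun m₂ hm₂ => ?_).le
    rw [if_neg]
    rintro ⟨c1, c2, c3, c4, c5⟩
    apply hRC
    have hm₁d : m₁ ∣ n := Nat.dvd_of_mem_divisors hm₁
    have hm₂d : m₂ ∣ n + h := Nat.dvd_of_mem_divisors hm₂
    have hm₁0 : 0 < m₁ := Nat.pos_of_mem_divisors hm₁
    have hm₂0 : 0 < m₂ := Nat.pos_of_mem_divisors hm₂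
    have hq₁ : 0 < n / m₁ := Nat.div_pos (Nat.le_of_dvd (Nat.pos_of_ne_zero hn) hm₁d) hm₁0
    have hq₂ : 0 < (n + h) / m₂ := Nat.div_pos (Nat.le_of_dvd (Nat.pos_of_ne_zero hnh) hm₂d) hm₂0
    constructor
    · intro p hp
      have hpp : p.Prime := Nat.prime_of_mem_primeFactors hp
      have hpn : p ∣ m₁ * (n / m₁) := by rw [Nat.mul_div_cancel' hm₁d]; exact Nat.dvd_of_mem_primeFactors hp
      rcases hpp.dvd_mul.mp hpn with h1 | h1
      · exact hw₁ p hpp (Or.inr (c3 p (Nat.mem_primeFactors.mpr ⟨hpp, h1, by omega⟩)))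
      · exact hw₁ p hpp (Or.inl (c1 p (Nat.mem_primeFactors.mpr ⟨hpp, h1, by omega⟩)))
    · intro p hp
      have hpp : p.Prime := Nat.prime_of_mem_primeFactors hp
      have hpn : p ∣ m₂ * ((n + h) / m₂) := by
        rw [Nat.mul_div_cancel' hm₂d]; exact Nat.dvd_of_mem_primeFactors hp
      rcases hpp.dvd_mul.mp hpn with h1 | h1
      · exact Or.inl (hw₂ p hpp (Or.inr (c5 p (Nat.mem_primeFactors.mpr ⟨hpp, h1, by omega⟩))))
      · rcases c2 p (Nat.mem_primeFactors.mpr ⟨hpp, h1, by omega⟩) with h2 | h2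
        · exact Or.inl (hw₂ p hpp (Or.inl h2))
        · exact Or.inr h2

/-! ### (2.6) -/

set_option maxHeartbeats 800000 in
/-- **Matomäki–Merikoski, (2.6) of the arXiv version ("ConsHenriot")**, sign `+`: for `A ≥ 1` there is
`β₀` such that for every `β ≥ β₀` there is `C = C(A, β)` with, for all `u ≥ 1000β`, `X ≥ 2`,
`1 ≤ h ≤ X^{10}` and `R`,
`∑_{r ∈ [0,R)³, max r_j ≥ u/1000 − β} 2^{−A(r₁+r₂+r₃)} ∑_{n ≤ 10X} ∑_{m₁ ∣ n} ∑_{m₂ ∣ n+h}`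
`1[(n/m₁, P(z_{r₁})) = ((n+h)/m₂, P_h(z_{r₂})) = 1, (m₁, P(z_{r₃})) = (m₂, hP(z)) = 1] (τ(m₁)τ(n/m₁)τ((n+h)/m₂))^{A+1}`
`≤ C (h/φ(h)) (X/log² X) e^{−Au/2000}`, where `z = X^{1/u}`, `z_r = z^{(1−1/β)^r}` (p. 7; the source's
"`β` sufficiently large in terms of `A`, `u ≥ 1000β`", proof on p. 10 via Lemma 3.1(i); here via the
tree's coarse form of that lemma). [cite: MatomakiMerikoski2023, §2 (2.6)] -/
theorem MatomakiMerikoski2023_consHenriot (A : ℕ) (hA : 1 ≤ A) : ∃ β₀ : ℝ, 2 ≤ β₀ ∧ ∀ β : ℝ, β₀ ≤ β →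
    ∃ C : ℝ, 0 < C ∧ ∀ (u X : ℝ) (h R : ℕ), 1000 * β ≤ u → 2 ≤ X → 1 ≤ h → (h : ℝ) ≤ X ^ 10 →
      ∑ r ∈ ((Finset.range R ×ˢ Finset.range R) ×ˢ Finset.range R).filter
          (fun r : (ℕ × ℕ) × ℕ => u / 1000 - β ≤ ((max (max r.1.1 r.1.2) r.2 : ℕ) : ℝ)),
        1 / (2 : ℝ) ^ (A * (r.1.1 + r.1.2 + r.2)) *
          ∑ n ∈ Icc 1 ⌊10 * X⌋₊, ∑ m₁ ∈ n.divisors, ∑ m₂ ∈ (n + h).divisors,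
            (if (∀ p ∈ (n / m₁).primeFactors, (X ^ (1 / u)) ^ ((1 - 1 / β) ^ r.1.1) ≤ (p : ℝ)) ∧
                (∀ p ∈ ((n + h) / m₂).primeFactors,
                  (X ^ (1 / u)) ^ ((1 - 1 / β) ^ r.1.2) ≤ (p : ℝ) ∨ p ∣ h) ∧
                (∀ p ∈ m₁.primeFactors, (X ^ (1 / u)) ^ ((1 - 1 / β) ^ r.2) ≤ (p : ℝ)) ∧
                (Nat.Coprime m₂ h ∧ ∀ p ∈ m₂.primeFactors, X ^ (1 / u) ≤ (p : ℝ))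
              then (((m₁.divisors.card * (n / m₁).divisors.card *
                ((n + h) / m₂).divisors.card : ℕ) : ℝ)) ^ (A + 1)
              else 0) ≤
        C * ((h : ℝ) / Nat.totient h) * X / Real.log X ^ 2 * Real.exp (-(A : ℝ) * u / 2000) := by
  obtain ⟨C₁, hC₁, κ, HF⟩ :=
    Literature.NumberTheory.Sieve.PairDivisorSums.sum_pow_card_divisors_shift_le (2 * A + 3) (A + 2) 10
  have hA0 : (0 : ℝ) < A := by exact_mod_cast hA
  have hA1 : (1 : ℝ) ≤ A := by exact_mod_cast hA
  have hκ15 : (0 : ℝ) ≤ 15 * ((κ : ℝ) + 1) / A := by positivity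
  refine ⟨2 + 15 * ((κ : ℝ) + 1) / A, by linarith, ?_⟩
  intro β hβ
  have hβ2 : 2 ≤ β := by linarith
  have hβ1 : 1 < β := by linarith
  have hβ0 : 0 < β := by linarith
  have hβ1' : β - 1 ≠ 0 := by
    intro h0
    linarith
  have hlog2 : (0.6931471803 : ℝ) < Real.log 2 := Real.log_two_gt_d9
  have hlog2' : Real.log 2 < 0.6931471808 := Real.log_two_lt_d9
  -- `ρ = β/(β−1)` and `q = ρ^{κ+1}/2^A ≤ 2^{−0.9A} ≤ 2/3`
  obtain ⟨ρ, hρ⟩ : ∃ ρ : ℝ, ρ = β / (β - 1) := ⟨_, rfl⟩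
  have hρ1 : 1 ≤ ρ := by rw [hρ, le_div_iff₀ (by linarith)]; linarith
  have hρ0 : 0 < ρ := by linarith
  have hρpow : ρ ^ (κ + 1) ≤ Real.exp ((A : ℝ) * Real.log 2 / 10) := by
    have hlogρ : Real.log ρ ≤ 1 / (β - 1) := by
      have h := Real.log_le_sub_one_of_pos hρ0
      have : ρ - 1 = 1 / (β - 1) := by
        rw [hρ, div_sub_one hβ1']
        congr 1
        ring
      linarith
    rw [← Real.exp_log (pow_pos hρ0 _), Real.exp_le_exp, Real.log_pow]
    have h1 : ((κ + 1 : ℕ) : ℝ) * Real.log ρ ≤ ((κ : ℝ) + 1) * (1 / (β - 1)) := by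
      push_cast
      exact mul_le_mul_of_nonneg_left hlogρ (by positivity)
    have h2 : ((κ : ℝ) + 1) * (1 / (β - 1)) ≤ (A : ℝ) * Real.log 2 / 10 := by
      rw [← mul_div_assoc, mul_one, div_le_div_iff₀ (by linarith) (by norm_num)]
      have h' : 15 * ((κ : ℝ) + 1) / A ≤ β - 2 := by linarith
      rw [div_le_iff₀ hA0] at h'
      nlinarith
    exact h1.trans h2
  obtain ⟨q, hq⟩ : ∃ q : ℝ, q = ρ ^ (κ + 1) / (2 : ℝ) ^ A := ⟨_, rfl⟩
  have hq0 : 0 < q := by rw [hq]; positivity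
  have h2A : (2 : ℝ) ^ A = Real.exp ((A : ℝ) * Real.log 2) := by
    rw [← Real.rpow_natCast, Real.rpow_def_of_pos (by norm_num), mul_comm]
  have hqexp : q ≤ Real.exp (-(0.9 : ℝ) * A * Real.log 2) := by
    rw [hq, div_le_iff₀ (by positivity), h2A, ← Real.exp_add]
    refine hρpow.trans (Real.exp_le_exp.mpr ?_)
    nlinarith
  have hq23 : q ≤ 2 / 3 := by
    refine hqexp.trans ?_
    have h1 : Real.exp (-(0.9 : ℝ) * A * Real.log 2) ≤ Real.exp (-(1 / 2 : ℝ)) :=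
      Real.exp_le_exp.mpr (by nlinarith)
    refine h1.trans ?_
    have h2 : (1 / 2 : ℝ) + 1 ≤ Real.exp (1 / 2) := Real.add_one_le_exp _
    rw [Real.exp_neg, inv_le_comm₀ (Real.exp_pos _) (by norm_num)]
    norm_num at h2 ⊢
    linarith
  -- the `u`-power absorption
  obtain ⟨δ, hδ⟩ : ∃ δ : ℝ, δ = 0.0001 * A := ⟨_, rfl⟩
  have hδ0 : 0 < δ := by rw [hδ]; positivity
  obtain ⟨Kp, hKp⟩ : ∃ K : ℝ, K = ((2 * κ + 2).factorial : ℝ) / δ ^ (2 * κ + 2) := ⟨_, rfl⟩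
  have hKp0 : 0 < Kp := by rw [hKp]; positivity
  obtain ⟨C₂, hC₂⟩ : ∃ C₂ : ℝ, C₂ = 10 * 25 ^ κ * C₁ := ⟨_, rfl⟩
  have hC₂0 : 0 < C₂ := by rw [hC₂]; positivity
  refine ⟨81 * C₂ * Real.exp (0.9 * A * Real.log 2 * β) * Kp, by positivity, ?_⟩
  intro u X h R hu hX hh hhX
  -- basic facts
  have hu0 : 0 < u := by linarith
  have hu1 : 1 ≤ u := by linarith
  have hX0 : 0 < X := by linarith
  have hX1 : 1 ≤ X := by linarith
  have hlogX : 0 < Real.log X := Real.log_pos (by linarith)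
  have hh0 : h ≠ 0 := by omega
  set x : ℕ := ⌊10 * X⌋₊ with hxdef
  have hx10 : (x : ℝ) ≤ 10 * X := Nat.floor_le (by linarith)
  have hxX : X ≤ (x : ℝ) := by
    have := Nat.lt_floor_add_one (10 * X)
    linarith
  have hx2 : 2 ≤ x := by
    have : (2 : ℝ) ≤ x := by linarith
    exact_mod_cast this
  have hx0 : (0 : ℝ) < x := by linarith
  have hlogx : Real.log x ≤ 5 * Real.log X := by
    have h1 : Real.log x ≤ Real.log (10 * X) := Real.log_le_log hx0 hx10
    rw [Real.log_mul (by norm_num) hX0.ne'] at h1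
    have h2 : Real.log 10 ≤ Real.log 16 := Real.log_le_log (by norm_num) (by norm_num)
    have h3 : Real.log 16 = 4 * Real.log 2 := by
      rw [show (16 : ℝ) = 2 ^ 4 by norm_num, Real.log_pow]; norm_num
    have h4 : Real.log 2 ≤ Real.log X := Real.log_le_log (by norm_num) hX
    linarith
  have hlogx0 : 0 ≤ Real.log x := Real.log_nonneg (by linarith)
  have hhB : (h : ℝ) ≤ (x : ℝ) ^ 10 := hhX.trans (pow_le_pow_left₀ hX0.le hxX 10)
  obtain ⟨F, hF⟩ : ∃ F : ℝ, F = (h : ℝ) / Nat.totient h := ⟨_, rfl⟩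
  have hF0 : 0 ≤ F := by rw [hF]; positivity
  rw [← hF]
  -- the levels `z^(e^r)`, `z = X^{1/u}`, `e = 1 − 1/β`
  set z : ℝ := X ^ (1 / u) with hz
  have hzpos : 0 < z := by positivity
  have hz1 : 1 ≤ z := Real.one_le_rpow hX1 (by positivity)
  have hzX : z ≤ X := by
    calc z = X ^ (1 / u) := rfl
      _ ≤ X ^ (1 : ℝ) := Real.rpow_le_rpow_of_exponent_le hX1 (by rw [div_le_one hu0]; exact hu1)
      _ = X := Real.rpow_one X
  set e : ℝ := 1 - 1 / β with he
  have he0 : 0 ≤ e := by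
    rw [he, sub_nonneg, div_le_one hβ0]; linarith
  have he1 : e ≤ 1 := by
    rw [he]; have : 0 ≤ 1 / β := by positivity
    linarith
  have heρ : e * ρ = 1 := by
    rw [he, hρ, one_sub_div hβ0.ne', div_mul_div_comm, mul_comm (β - 1) β]
    exact div_self (mul_ne_zero hβ0.ne' hβ1')
  have ht1 : ∀ r : ℕ, 1 ≤ z ^ (e ^ r) := fun r => Real.one_le_rpow hz1 (by positivity)
  have htz : ∀ r : ℕ, z ^ (e ^ r) ≤ z := fun r => by
    calc z ^ (e ^ r) ≤ z ^ (1 : ℝ) := Real.rpow_le_rpow_of_exponent_le hz1 (pow_le_one₀ he0 he1)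
      _ = z := Real.rpow_one z
  have htanti : ∀ r r' : ℕ, r ≤ r' → z ^ (e ^ r') ≤ z ^ (e ^ r) := fun r r' hrr' =>
    Real.rpow_le_rpow_of_exponent_le hz1 (pow_le_pow_of_le_one he0 he1 hrr')
  have hlogt : ∀ r : ℕ, Real.log (z ^ (e ^ r)) = e ^ r * (1 / u) * Real.log X := fun r => by
    rw [Real.log_rpow hzpos, hz, Real.log_rpow hX0]; ring
  -- the sieving levels `w_r = max 2 (z^(e^r))`
  have hw2 : ∀ r : ℕ, (2 : ℝ) ≤ max 2 (z ^ (e ^ r)) := fun r => le_max_left _ _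
  have hwx : ∀ r : ℕ, max 2 (z ^ (e ^ r)) ≤ (x : ℝ) := fun r =>
    max_le (by linarith) (((htz r).trans hzX).trans hxX)
  have hwkey : ∀ r : ℕ, 1 / Real.log (max 2 (z ^ (e ^ r))) ≤ u * ρ ^ r / Real.log X := by
    intro r
    have hρr : 0 < u * ρ ^ r := by positivity
    have heρr : e ^ r * ρ ^ r = 1 := by rw [← mul_pow, heρ, one_pow]
    have hlw : 0 < Real.log (max 2 (z ^ (e ^ r))) := Real.log_pos (by linarith [hw2 r])
    rw [div_le_div_iff₀ hlw hlogX, one_mul]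
    have e1 : u * ρ ^ r * (e ^ r * (1 / u) * Real.log X) = (e ^ r * ρ ^ r) * Real.log X := by
      calc u * ρ ^ r * (e ^ r * (1 / u) * Real.log X) = (u * (1 / u)) * (e ^ r * ρ ^ r) * Real.log X := by
            ring
        _ = (e ^ r * ρ ^ r) * Real.log X := by rw [mul_one_div_cancel hu0.ne', one_mul]
    by_cases h2 : (2 : ℝ) ≤ z ^ (e ^ r)
    · rw [max_eq_right h2, hlogt r, e1, heρr, one_mul]
    · push Not at h2
      rw [max_eq_left h2.le]
      have hlt : Real.log (z ^ (e ^ r)) < Real.log 2 := Real.log_lt_log (by linarith [ht1 r]) h2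
      rw [hlogt r] at hlt
      have h3 := mul_lt_mul_of_pos_left hlt hρr
      rw [e1, heρr, one_mul] at h3
      linarith
  -- the inner sums, abbreviated
  set IS : (ℕ × ℕ) × ℕ → ℝ := fun r => ∑ n ∈ Icc 1 x, ∑ m₁ ∈ n.divisors, ∑ m₂ ∈ (n + h).divisors,
      (if (∀ p ∈ (n / m₁).primeFactors, z ^ (e ^ r.1.1) ≤ (p : ℝ)) ∧
          (∀ p ∈ ((n + h) / m₂).primeFactors, z ^ (e ^ r.1.2) ≤ (p : ℝ) ∨ p ∣ h) ∧
          (∀ p ∈ m₁.primeFactors, z ^ (e ^ r.2) ≤ (p : ℝ)) ∧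
          (Nat.Coprime m₂ h ∧ ∀ p ∈ m₂.primeFactors, z ≤ (p : ℝ))
        then (((m₁.divisors.card * (n / m₁).divisors.card *
          ((n + h) / m₂).divisors.card : ℕ) : ℝ)) ^ (A + 1)
        else 0) with hIS
  -- per-`r` bound
  have hper : ∀ r : (ℕ × ℕ) × ℕ, 1 / (2 : ℝ) ^ (A * (r.1.1 + r.1.2 + r.2)) * IS r ≤
      C₂ * (F * X / Real.log X ^ 2) * u ^ (2 * κ + 2) * q ^ (r.1.1 + r.1.2 + r.2) := by
    intro r
    -- w₁ = max 2 (z^(e^R₁)), R₁ = max r₁ r₃; w₂ = max 2 (z^(e^r₂))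
    have hinner : IS r ≤ ∑ n ∈ (Icc 1 x).filter (fun n : ℕ =>
        (∀ p ∈ n.primeFactors, max 2 (z ^ (e ^ (max r.1.1 r.2))) ≤ (p : ℝ)) ∧
          (∀ p ∈ (n + h).primeFactors, max 2 (z ^ (e ^ r.1.2)) ≤ (p : ℝ) ∨ p ∣ h)),
        ((n.divisors.card : ℝ)) ^ (2 * A + 3) * (((n + h).divisors.card : ℝ)) ^ (A + 2) := by
      rw [hIS]
      dsimp only
      rw [Finset.sum_filter]
      refine Finset.sum_le_sum fun n hn => ?_
      rw [Finset.mem_Icc] at hn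
      refine inner_divisor_sum_le A (by omega) (by omega) ?_ ?_
      · intro p hp hor
        refine max_le (by exact_mod_cast hp.two_le) ?_
        rcases hor with h1 | h1
        · exact (htanti _ _ (le_max_left _ _)).trans h1
        · exact (htanti _ _ (le_max_right _ _)).trans h1
      · intro p hp hor
        refine max_le (by exact_mod_cast hp.two_le) ?_
        rcases hor with h1 | h1
        · exact h1
        · exact (htz _).trans h1
    have hHF := HF x h hx2 hh hhB (max 2 (z ^ (e ^ (max r.1.1 r.2)))) (max 2 (z ^ (e ^ r.1.2)))
      (hw2 _) (hwx _) (hw2 _) (hwx _)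
    rw [← hF] at hHF
    have hscale := scale_bound κ hC₁.le hF0 hX0.le hx10 hlogX hlogx0 hlogx
      (Real.log_pos (by linarith [hw2 (max r.1.1 r.2)])) (Real.log_pos (by linarith [hw2 r.1.2]))
      (hwkey (max r.1.1 r.2)) (hwkey r.1.2)
    have hcomb : (u * ρ ^ (max r.1.1 r.2)) ^ (κ + 1) * (u * ρ ^ r.1.2) ^ (κ + 1) ≤
        u ^ (2 * κ + 2) * (ρ ^ (κ + 1)) ^ (r.1.1 + r.1.2 + r.2) := by
      have hR₁le : max r.1.1 r.2 ≤ r.1.1 + r.2 := max_le (Nat.le_add_right _ _) (Nat.le_add_left _ _)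
      calc (u * ρ ^ (max r.1.1 r.2)) ^ (κ + 1) * (u * ρ ^ r.1.2) ^ (κ + 1)
          = u ^ (2 * κ + 2) * (ρ ^ (κ + 1)) ^ (max r.1.1 r.2 + r.1.2) := by ring
        _ ≤ u ^ (2 * κ + 2) * (ρ ^ (κ + 1)) ^ (r.1.1 + r.1.2 + r.2) := by
            refine mul_le_mul_of_nonneg_left (pow_le_pow_right₀ (one_le_pow₀ hρ1) (by omega))
              (by positivity)
    have hweight : 1 / (2 : ℝ) ^ (A * (r.1.1 + r.1.2 + r.2)) * (ρ ^ (κ + 1)) ^ (r.1.1 + r.1.2 + r.2) =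
        q ^ (r.1.1 + r.1.2 + r.2) := by
      rw [hq, div_pow, pow_mul]
      field_simp
    have hwt0 : (0 : ℝ) ≤ 1 / (2 : ℝ) ^ (A * (r.1.1 + r.1.2 + r.2)) := by positivity
    calc 1 / (2 : ℝ) ^ (A * (r.1.1 + r.1.2 + r.2)) * IS r
        ≤ 1 / (2 : ℝ) ^ (A * (r.1.1 + r.1.2 + r.2)) * (C₂ * (F * X / Real.log X ^ 2) *
            ((u * ρ ^ (max r.1.1 r.2)) ^ (κ + 1) * (u * ρ ^ r.1.2) ^ (κ + 1))) := by
          refine mul_le_mul_of_nonneg_left (hinner.trans (hHF.trans ?_)) hwt0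
          rw [hC₂]; exact hscale
      _ ≤ 1 / (2 : ℝ) ^ (A * (r.1.1 + r.1.2 + r.2)) * (C₂ * (F * X / Real.log X ^ 2) *
            (u ^ (2 * κ + 2) * (ρ ^ (κ + 1)) ^ (r.1.1 + r.1.2 + r.2))) :=
          mul_le_mul_of_nonneg_left (mul_le_mul_of_nonneg_left hcomb (by positivity)) hwt0
      _ = C₂ * (F * X / Real.log X ^ 2) * u ^ (2 * κ + 2) *
            (1 / (2 : ℝ) ^ (A * (r.1.1 + r.1.2 + r.2)) * (ρ ^ (κ + 1)) ^ (r.1.1 + r.1.2 + r.2)) := by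
          ring
      _ = _ := by rw [hweight]
  -- the numerical tail: `u^{2κ+2} q^{⌈u/1000 − β⌉} ≤ e^{0.9 A log2 β} Kp e^{−Au/2000}`
  have hfinal : u ^ (2 * κ + 2) * q ^ ⌈u / 1000 - β⌉₊ ≤
      Real.exp (0.9 * A * Real.log 2 * β) * Kp * Real.exp (-(A : ℝ) * u / 2000) := by
    have hk : 0 < 0.9 * (A : ℝ) * Real.log 2 := by positivity
    have h1 : q ^ ⌈u / 1000 - β⌉₊ ≤ Real.exp (-(0.9 : ℝ) * A * Real.log 2 * (u / 1000 - β)) := by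
      calc q ^ ⌈u / 1000 - β⌉₊ ≤ (Real.exp (-(0.9 : ℝ) * A * Real.log 2)) ^ ⌈u / 1000 - β⌉₊ :=
            pow_le_pow_left₀ hq0.le hqexp _
        _ = Real.exp (-(0.9 : ℝ) * A * Real.log 2 * ⌈u / 1000 - β⌉₊) := by
            rw [← Real.exp_nat_mul]; ring_nf
        _ ≤ Real.exp (-(0.9 : ℝ) * A * Real.log 2 * (u / 1000 - β)) := by
            refine Real.exp_le_exp.mpr ?_
            have hc := Nat.le_ceil (u / 1000 - β)
            nlinarith
    have h2 : u ^ (2 * κ + 2) * Real.exp (-(δ * u)) ≤ Kp := by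
      rw [hKp]; exact pow_mul_exp_neg_le' _ hδ0 hu0.le
    have h3 : Real.exp (-(0.9 : ℝ) * A * Real.log 2 * (u / 1000 - β)) ≤
        Real.exp (0.9 * A * Real.log 2 * β) * (Real.exp (-(δ * u)) * Real.exp (-(A : ℝ) * u / 2000)) := by
      rw [← Real.exp_add, ← Real.exp_add, Real.exp_le_exp, hδ]
      nlinarith [mul_nonneg hA0.le hu0.le]
    calc u ^ (2 * κ + 2) * q ^ ⌈u / 1000 - β⌉₊
        ≤ u ^ (2 * κ + 2) * (Real.exp (0.9 * A * Real.log 2 * β) *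
            (Real.exp (-(δ * u)) * Real.exp (-(A : ℝ) * u / 2000))) :=
          mul_le_mul_of_nonneg_left (h1.trans h3) (by positivity)
      _ = Real.exp (0.9 * A * Real.log 2 * β) * (u ^ (2 * κ + 2) * Real.exp (-(δ * u))) *
            Real.exp (-(A : ℝ) * u / 2000) := by ring
      _ ≤ Real.exp (0.9 * A * Real.log 2 * β) * Kp * Real.exp (-(A : ℝ) * u / 2000) := by
          refine mul_le_mul_of_nonneg_right (mul_le_mul_of_nonneg_left h2 (by positivity)) (by positivity)
  -- assemble
  have hgoal : ∑ r ∈ ((Finset.range R ×ˢ Finset.range R) ×ˢ Finset.range R).filter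
        (fun r : (ℕ × ℕ) × ℕ => u / 1000 - β ≤ ((max (max r.1.1 r.1.2) r.2 : ℕ) : ℝ)),
      1 / (2 : ℝ) ^ (A * (r.1.1 + r.1.2 + r.2)) * IS r ≤
      81 * C₂ * Real.exp (0.9 * A * Real.log 2 * β) * Kp * F * X / Real.log X ^ 2 *
        Real.exp (-(A : ℝ) * u / 2000) := by
    calc _ ≤ ∑ r ∈ ((Finset.range R ×ˢ Finset.range R) ×ˢ Finset.range R).filter
          (fun r : (ℕ × ℕ) × ℕ => u / 1000 - β ≤ ((max (max r.1.1 r.1.2) r.2 : ℕ) : ℝ)),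
          C₂ * (F * X / Real.log X ^ 2) * u ^ (2 * κ + 2) * q ^ (r.1.1 + r.1.2 + r.2) :=
          Finset.sum_le_sum fun r _ => hper r
      _ = C₂ * (F * X / Real.log X ^ 2) * u ^ (2 * κ + 2) *
          ∑ r ∈ ((Finset.range R ×ˢ Finset.range R) ×ˢ Finset.range R).filter
            (fun r : (ℕ × ℕ) × ℕ => u / 1000 - β ≤ ((max (max r.1.1 r.1.2) r.2 : ℕ) : ℝ)),
            q ^ (r.1.1 + r.1.2 + r.2) := by rw [Finset.mul_sum]
      _ ≤ C₂ * (F * X / Real.log X ^ 2) * u ^ (2 * κ + 2) * (81 * q ^ ⌈u / 1000 - β⌉₊) :=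
          mul_le_mul_of_nonneg_left (triple_geom_le hq0.le hq23 R _) (by positivity)
      _ = 81 * C₂ * (F * X / Real.log X ^ 2) * (u ^ (2 * κ + 2) * q ^ ⌈u / 1000 - β⌉₊) := by ring
      _ ≤ 81 * C₂ * (F * X / Real.log X ^ 2) *
          (Real.exp (0.9 * A * Real.log 2 * β) * Kp * Real.exp (-(A : ℝ) * u / 2000)) :=
          mul_le_mul_of_nonneg_left hfinal (by positivity)
      _ = _ := by ring
  simpa only [hIS] using hgoal

end Literature.Barriers.Parity.MatomakiMerikoski
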